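import Mathlib
import HarnessLib

/-!
# `NoHeavyLowerTail` (crux stmt-CriticalPhenomena-4575), antithetic vdBHK programme: the BROOM CHARGE INEQUALITY

Support file (seat `prim-ineq-gen-7` gen 26; `--supports stmt-CriticalPhenomena-4575`).  Nothing is asserted about the crux; no `sorry`,
no definitions.  Memo: run/shared/lean/prim/prim-ineq-gen-7/FINDING-PATHS-g26.md §3b (THEOREM J: the per-tree certificate inequality `(***)`
of the tree-block reduction holds for every BROOM — a root edge followed by a star of any size — hence, with the subdivision theorem of
the same memo, for every pendant 'path + star'; RAA and ULEX for the corresponding unicyclic graphs follow by FINDING-TREEBLOCK-g25).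

CONTEXT.  For the broom the colouring poset is two antichains indexed by `Ω = 2^[r]` (bottoms `(R,γ)` below all tops `(B,γ)`), the
involution is `(R,γ) ↔ (B,γᶜ)`, an up-set is a pair (top part `X`, bottom part `X°`) of subsets of `Ω` with `X° ≠ ∅ ⇒ X = Ω`, the bottom
certificates are antipodal and the top certificates, after a harmless weakening, become pointwise.  The whole inequality is then a sum over
antipodal pairs `{γ, γᶜ}` of a weight in 16 bits which is nonnegative whenever, for each of the four up-sets, either both top bits are set or
both bottom bits are clear.

* `AntitheticBroom.broom_local` — the pair weight is `≥ 0` (via a 12-bit parametrisation, one `decide`).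
* `AntitheticBroom.broom_charge` — the BROOM CHARGE INEQUALITY: for families `A, A°, A′, A′°, B, B°, B′, B′° ⊆ 2^β` such that for every `y`
  and each letter either `y, yᶜ ∈ X` or `y, yᶜ ∉ X°`, the sum over `y` of the pointwise value (four products, four crossed products with `yᶜ`,
  bottom certificate, weakened top certificate) is `≥ 0`.
-/

namespace Summit.CriticalPhenomena.PercolationContinuityZ3.Theorems

open Finset

namespace AntitheticBroom

set_option synthInstance.maxSize 100000 in
/-- The pair weight in the 12-bit parametrisation `X = s || u`, `X̄ = s || v`, `X° = s && u`, `X̄° = s && v` (which enumerates exactly the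
admissible pair types); `2^12` cases by `decide`. -/
private theorem broom_param : ∀ (sa ua va sa2 ua2 va2 sb ub vb sb2 ub2 vb2 : Bool),
    0 ≤ ((if (sa && ua) then (1:ℤ) else 0) * (if (sb && ub) then (1:ℤ) else 0)
          + (if (sa2 || ua2) then (1:ℤ) else 0) * (if (sb2 || ub2) then (1:ℤ) else 0)
          + (if (sa || ua) then (1:ℤ) else 0) * (if (sb || ub) then (1:ℤ) else 0)
          + (if (sa2 && ua2) then (1:ℤ) else 0) * (if (sb2 && ub2) then (1:ℤ) else 0)
          - (if (sa && ua) then (1:ℤ) else 0) * (if (sb2 || vb2) then (1:ℤ) else 0)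
          - (if (sa2 || va2) then (1:ℤ) else 0) * (if (sb && ub) then (1:ℤ) else 0)
          - (if (sa || ua) then (1:ℤ) else 0) * (if (sb2 && vb2) then (1:ℤ) else 0)
          - (if (sa2 && va2) then (1:ℤ) else 0) * (if (sb || ub) then (1:ℤ) else 0)
        + (if (((sa || va) ∧ (sb2 || vb2) ∧ ¬ (sa2 && ua2) ∧ ¬ (sb && ub)) ∨ ((sa2 || va2) ∧ (sb || vb) ∧ ¬ (sa && ua) ∧ ¬ (sb2 && ub2))) then (1:ℤ) else 0)
        + (if (((sa && ua) ∧ (sb2 && ub2) ∧ ¬ (sa2 || ua2) ∧ ¬ (sb || ub)) ∨ ((sa2 && ua2) ∧ (sb && ub) ∧ ¬ (sa || ua) ∧ ¬ (sb2 || ub2))) then (1:ℤ) else 0))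
      + ((if (sa && va) then (1:ℤ) else 0) * (if (sb && vb) then (1:ℤ) else 0)
          + (if (sa2 || va2) then (1:ℤ) else 0) * (if (sb2 || vb2) then (1:ℤ) else 0)
          + (if (sa || va) then (1:ℤ) else 0) * (if (sb || vb) then (1:ℤ) else 0)
          + (if (sa2 && va2) then (1:ℤ) else 0) * (if (sb2 && vb2) then (1:ℤ) else 0)
          - (if (sa && va) then (1:ℤ) else 0) * (if (sb2 || ub2) then (1:ℤ) else 0)
          - (if (sa2 || ua2) then (1:ℤ) else 0) * (if (sb && vb) then (1:ℤ) else 0)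
          - (if (sa || va) then (1:ℤ) else 0) * (if (sb2 && ub2) then (1:ℤ) else 0)
          - (if (sa2 && ua2) then (1:ℤ) else 0) * (if (sb || vb) then (1:ℤ) else 0)
        + (if (((sa || ua) ∧ (sb2 || ub2) ∧ ¬ (sa2 && va2) ∧ ¬ (sb && vb)) ∨ ((sa2 || ua2) ∧ (sb || ub) ∧ ¬ (sa && va) ∧ ¬ (sb2 && vb2))) then (1:ℤ) else 0)
        + (if (((sa && va) ∧ (sb2 && vb2) ∧ ¬ (sa2 || va2) ∧ ¬ (sb || vb)) ∨ ((sa2 && va2) ∧ (sb && vb) ∧ ¬ (sa || va) ∧ ¬ (sb2 || vb2))) then (1:ℤ) else 0)) := by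
  decide

/-- **LOCAL BROOM INEQUALITY** (memo §3b).  Sixteen bits: membership of `γ` (no suffix) and of `γᶜ` (suffix `c`) in the top parts
`A, A2, B, B2` and bottom parts `Ao, A2o, Bo, B2o` of the four up-sets `a, a′, b, b′`; for each letter either both top bits are `true` or
both bottom bits are `false`.  Then the pair weight (value at `γ` plus value at `γᶜ`) is nonnegative. [this work] -/
theorem broom_local (A Ao A2 A2o B Bo B2 B2o Ac Aoc A2c A2oc Bc Boc B2c B2oc : Bool)
    (ha : (A = true ∧ Ac = true) ∨ (Ao = false ∧ Aoc = false)) (ha2 : (A2 = true ∧ A2c = true) ∨ (A2o = false ∧ A2oc = false))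
    (hb : (B = true ∧ Bc = true) ∨ (Bo = false ∧ Boc = false)) (hb2 : (B2 = true ∧ B2c = true) ∨ (B2o = false ∧ B2oc = false)) :
    0 ≤ ((if Ao then (1:ℤ) else 0) * (if Bo then (1:ℤ) else 0)
          + (if A2 then (1:ℤ) else 0) * (if B2 then (1:ℤ) else 0)
          + (if A then (1:ℤ) else 0) * (if B then (1:ℤ) else 0)
          + (if A2o then (1:ℤ) else 0) * (if B2o then (1:ℤ) else 0)
          - (if Ao then (1:ℤ) else 0) * (if B2c then (1:ℤ) else 0)
          - (if A2c then (1:ℤ) else 0) * (if Bo then (1:ℤ) else 0)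
          - (if A then (1:ℤ) else 0) * (if B2oc then (1:ℤ) else 0)
          - (if A2oc then (1:ℤ) else 0) * (if B then (1:ℤ) else 0)
        + (if ((Ac ∧ B2c ∧ ¬ A2o ∧ ¬ Bo) ∨ (A2c ∧ Bc ∧ ¬ Ao ∧ ¬ B2o)) then (1:ℤ) else 0)
        + (if ((Ao ∧ B2o ∧ ¬ A2 ∧ ¬ B) ∨ (A2o ∧ Bo ∧ ¬ A ∧ ¬ B2)) then (1:ℤ) else 0))
      + ((if Aoc then (1:ℤ) else 0) * (if Boc then (1:ℤ) else 0)
          + (if A2c then (1:ℤ) else 0) * (if B2c then (1:ℤ) else 0)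
          + (if Ac then (1:ℤ) else 0) * (if Bc then (1:ℤ) else 0)
          + (if A2oc then (1:ℤ) else 0) * (if B2oc then (1:ℤ) else 0)
          - (if Aoc then (1:ℤ) else 0) * (if B2 then (1:ℤ) else 0)
          - (if A2 then (1:ℤ) else 0) * (if Boc then (1:ℤ) else 0)
          - (if Ac then (1:ℤ) else 0) * (if B2o then (1:ℤ) else 0)
          - (if A2o then (1:ℤ) else 0) * (if Bc then (1:ℤ) else 0)
        + (if ((A ∧ B2 ∧ ¬ A2oc ∧ ¬ Boc) ∨ (A2 ∧ B ∧ ¬ Aoc ∧ ¬ B2oc)) then (1:ℤ) else 0)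
        + (if ((Aoc ∧ B2oc ∧ ¬ A2c ∧ ¬ Bc) ∨ (A2oc ∧ Boc ∧ ¬ Ac ∧ ¬ B2c)) then (1:ℤ) else 0)) := by
  rcases ha with ⟨h1, h2⟩ | ⟨h1, h2⟩ <;> rcases ha2 with ⟨h3, h4⟩ | ⟨h3, h4⟩ <;> rcases hb with ⟨h5, h6⟩ | ⟨h5, h6⟩ <;>
    rcases hb2 with ⟨h7, h8⟩ | ⟨h7, h8⟩ <;> subst h1 h2 h3 h4 h5 h6 h7 h8
  · simpa using broom_param true Ao Aoc true A2o A2oc true Bo Boc true B2o B2oc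
  · simpa using broom_param true Ao Aoc true A2o A2oc true Bo Boc false B2 B2c
  · simpa using broom_param true Ao Aoc true A2o A2oc false B Bc true B2o B2oc
  · simpa using broom_param true Ao Aoc true A2o A2oc false B Bc false B2 B2c
  · simpa using broom_param true Ao Aoc false A2 A2c true Bo Boc true B2o B2oc
  · simpa using broom_param true Ao Aoc false A2 A2c true Bo Boc false B2 B2c
  · simpa using broom_param true Ao Aoc false A2 A2c false B Bc true B2o B2oc
  · simpa using broom_param true Ao Aoc false A2 A2c false B Bc false B2 B2c
  · simpa using broom_param false A Ac true A2o A2oc true Bo Boc true B2o B2oc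
  · simpa using broom_param false A Ac true A2o A2oc true Bo Boc false B2 B2c
  · simpa using broom_param false A Ac true A2o A2oc false B Bc true B2o B2oc
  · simpa using broom_param false A Ac true A2o A2oc false B Bc false B2 B2c
  · simpa using broom_param false A Ac false A2 A2c true Bo Boc true B2o B2oc
  · simpa using broom_param false A Ac false A2 A2c true Bo Boc false B2 B2c
  · simpa using broom_param false A Ac false A2 A2c false B Bc true B2o B2oc
  · simpa using broom_param false A Ac false A2 A2c false B Bc false B2 B2c

variable {β : Type*} [DecidableEq β] [Fintype β]

/-- **BROOM CHARGE INEQUALITY** (memo §3b, THEOREM J).  Families `A, Ao, A2, A2o, B, Bo, B2, B2o` of subsets of `β` (top and bottom parts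
of the up-sets `a, a′, b, b′` of the broom poset, indexed by the red leaf set) such that for every `y` and each letter either `y, yᶜ` both
lie in the top part or both lie outside the bottom part (this holds when `X° ≠ ∅ ⇒ X = 2^β`).  Then the (weakened) value — four products,
minus four crossed products with the complement, plus the antipodal bottom certificate, plus the pointwise top certificate — sums to a
nonnegative integer.  Proof: the summand at `y` plus the summand at `yᶜ` is `broom_local`; reindex by `compl`. [this work] -/
theorem broom_charge (A Ao A2 A2o B Bo B2 B2o : Finset (Finset β))
    (ha : ∀ y : Finset β, (y ∈ A ∧ yᶜ ∈ A) ∨ (y ∉ Ao ∧ yᶜ ∉ Ao)) (ha2 : ∀ y : Finset β, (y ∈ A2 ∧ yᶜ ∈ A2) ∨ (y ∉ A2o ∧ yᶜ ∉ A2o))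
    (hb : ∀ y : Finset β, (y ∈ B ∧ yᶜ ∈ B) ∨ (y ∉ Bo ∧ yᶜ ∉ Bo)) (hb2 : ∀ y : Finset β, (y ∈ B2 ∧ yᶜ ∈ B2) ∨ (y ∉ B2o ∧ yᶜ ∉ B2o)) :
    0 ≤ ∑ y : Finset β, ((if y ∈ Ao then (1:ℤ) else 0) * (if y ∈ Bo then (1:ℤ) else 0)
          + (if y ∈ A2 then (1:ℤ) else 0) * (if y ∈ B2 then (1:ℤ) else 0)
          + (if y ∈ A then (1:ℤ) else 0) * (if y ∈ B then (1:ℤ) else 0)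
          + (if y ∈ A2o then (1:ℤ) else 0) * (if y ∈ B2o then (1:ℤ) else 0)
          - (if y ∈ Ao then (1:ℤ) else 0) * (if yᶜ ∈ B2 then (1:ℤ) else 0)
          - (if yᶜ ∈ A2 then (1:ℤ) else 0) * (if y ∈ Bo then (1:ℤ) else 0)
          - (if y ∈ A then (1:ℤ) else 0) * (if yᶜ ∈ B2o then (1:ℤ) else 0)
          - (if yᶜ ∈ A2o then (1:ℤ) else 0) * (if y ∈ B then (1:ℤ) else 0)
        + (if ((yᶜ ∈ A ∧ yᶜ ∈ B2 ∧ ¬ y ∈ A2o ∧ ¬ y ∈ Bo) ∨ (yᶜ ∈ A2 ∧ yᶜ ∈ B ∧ ¬ y ∈ Ao ∧ ¬ y ∈ B2o)) then (1:ℤ) else 0)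
        + (if ((y ∈ Ao ∧ y ∈ B2o ∧ ¬ y ∈ A2 ∧ ¬ y ∈ B) ∨ (y ∈ A2o ∧ y ∈ Bo ∧ ¬ y ∈ A ∧ ¬ y ∈ B2)) then (1:ℤ) else 0)) := by
  -- the summand
  set pt : Finset β → ℤ := fun y => ((if y ∈ Ao then (1:ℤ) else 0) * (if y ∈ Bo then (1:ℤ) else 0)
          + (if y ∈ A2 then (1:ℤ) else 0) * (if y ∈ B2 then (1:ℤ) else 0)
          + (if y ∈ A then (1:ℤ) else 0) * (if y ∈ B then (1:ℤ) else 0)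
          + (if y ∈ A2o then (1:ℤ) else 0) * (if y ∈ B2o then (1:ℤ) else 0)
          - (if y ∈ Ao then (1:ℤ) else 0) * (if yᶜ ∈ B2 then (1:ℤ) else 0)
          - (if yᶜ ∈ A2 then (1:ℤ) else 0) * (if y ∈ Bo then (1:ℤ) else 0)
          - (if y ∈ A then (1:ℤ) else 0) * (if yᶜ ∈ B2o then (1:ℤ) else 0)
          - (if yᶜ ∈ A2o then (1:ℤ) else 0) * (if y ∈ B then (1:ℤ) else 0)
        + (if ((yᶜ ∈ A ∧ yᶜ ∈ B2 ∧ ¬ y ∈ A2o ∧ ¬ y ∈ Bo) ∨ (yᶜ ∈ A2 ∧ yᶜ ∈ B ∧ ¬ y ∈ Ao ∧ ¬ y ∈ B2o)) then (1:ℤ) else 0)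
        + (if ((y ∈ Ao ∧ y ∈ B2o ∧ ¬ y ∈ A2 ∧ ¬ y ∈ B) ∨ (y ∈ A2o ∧ y ∈ Bo ∧ ¬ y ∈ A ∧ ¬ y ∈ B2)) then (1:ℤ) else 0)) with hpt
  have key : ∀ y : Finset β, 0 ≤ pt y + pt yᶜ := by
    intro y
    have h := broom_local (decide (y ∈ A)) (decide (y ∈ Ao)) (decide (y ∈ A2)) (decide (y ∈ A2o))
      (decide (y ∈ B)) (decide (y ∈ Bo)) (decide (y ∈ B2)) (decide (y ∈ B2o))
      (decide (yᶜ ∈ A)) (decide (yᶜ ∈ Ao)) (decide (yᶜ ∈ A2)) (decide (yᶜ ∈ A2o))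
      (decide (yᶜ ∈ B)) (decide (yᶜ ∈ Bo)) (decide (yᶜ ∈ B2)) (decide (yᶜ ∈ B2o))
      (by simpa using ha y) (by simpa using ha2 y) (by simpa using hb y) (by simpa using hb2 y)
    simp only [hpt, compl_compl]
    simpa only [decide_eq_true_eq, Bool.decide_and, Bool.decide_or, decide_not, compl_compl] using h
  have hre : ∑ y : Finset β, pt yᶜ = ∑ y : Finset β, pt y :=
    Equiv.sum_comp ⟨compl, compl, compl_compl, compl_compl⟩ pt
  have h2 : 0 ≤ ∑ y : Finset β, (pt y + pt yᶜ) := Finset.sum_nonneg (fun y _ => key y)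
  rw [Finset.sum_add_distrib, hre, ← two_mul] at h2
  have h3 : 0 ≤ ∑ y : Finset β, pt y := by linarith
  simpa only [hpt] using h3

end AntitheticBroom

end Summit.CriticalPhenomena.PercolationContinuityZ3.Theorems
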